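import Summits.CriticalPhenomena.SAWScalingLimit.Theorems.SAWRenewalTightnessRoomPassageEvents
import Literature.Probability.Process.DoobPassageData
import Literature.Probability.Process.FrozenCylinderExtension
import Literature.Probability.Process.DiagonalPassage
import Mathlib.MeasureTheory.Measure.Portmanteau
import HarnessLib

/-!
# Probability bookkeeping for the para passage: bounded-martingale passage data, the far-driver
# level, and the frozen extension of a complex cylinder identity
(crux `SubseqIdentification`, stmt-CriticalPhenomena-0783; line `parafermionic-martingale`, helpers of the
split piece S3c `stub_paraPassageAssembly` of the XL passage stub `stub_paraPassage`; stub-worker of the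
lead c6)

Three generic lemmas consumed by the diagonal passage of the line (`stub_paraPassageAssembly`):

* `exists_passageData_of_bounded` — the para twin of `Process.exists_passageData_of_doob`: from
  exploration data at all small tolerances `ρ` and all large scales `k` — a filtration, an EXACT
  complex martingale `G` bounded by a constant `C` (in the line: the Doob parafermionic observable
  frozen at the first bad past, bounded by S2 (1)), stopping times `σ ≤ τ ≤ M`, `𝒢_σ`-measurability of
  the driver values `V^k_u`, `u ≤ s`, and an exceptional event of probability `≤ ρ` off which `G_σ`,
  `G_τ` are within `ρ` of a target functional at times in `[s, s + ρ]`, `[t, t + ρ]` — to the per-scale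
  hypothesis `happrox` of the uniformly-integrable passage theorem (`stub_passageUI`, p101958): a
  diagonal extraction in the tolerance, Doob's optional sampling in pairing form
  (`Process.integral_stoppedValue_sub_mul_cylinder_eq_zero`), tails `≤ C ρ` by boundedness;
* `exists_farLevel` — the FAR-DRIVER LEVEL: for a probability law `μ` on curve classes with Borel
  driving process `W = drivingFunction φ`, a horizon `T` and `ρ > 0` there is `Ξ > 0` such that along
  every sequence of random continuous paths converging in distribution to a frozen limit driver
  `frozenDriver φ S₀`, `S₀ ≤ 1`, the event `{∃ u ≤ T, |V u| ≥ Ξ}` (closed in `C([0,∞), ℝ)`: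
  `isClosed_setOf_exists_le_abs`) has probability `< ρ` for all large indices (tightness of
  `sup_{[0, T+1]} |W|` + the closed-set half of the portmanteau theorem);
* `integral_sub_mul_eq_zero_of_forall_lt_of_frozen_complex` — the complex form of
  `Process.integral_sub_mul_eq_zero_of_forall_lt_of_frozen` + `…_zero_of_forall_pos`: a cylinder
  identity of a bounded continuous complex process frozen after `T`, known for `0 < s < t < T`, holds
  for all `s ≤ t` (real and imaginary parts).

References: D. Chelkak, H. Duminil-Copin, C. Hongler, A. Kemppainen, S. Smirnov, C. R. Math. 352
(2014), §3; P. Billingsley, *Convergence of Probability Measures* (1999), Thm. 2.1 (portmanteau);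
D. Williams, *Probability with Martingales* (1991), Thm. 10.10 (optional stopping).
-/

noncomputable section

open MeasureTheory Filter Topology Set
open scoped NNReal ENNReal Classical BigOperators
open Literature.Probability.LatticeModels
open Literature.Probability.RandomPlanarGeometry
open UpperHalfPlane (upperHalfPlaneSet)
open scoped PathBorel

namespace Summit.CriticalPhenomena.SAWScalingLimit.Theorems.SubseqIdentification.ParaMartingale

open Summit.CriticalPhenomena.SAWScalingLimit.Theorems.SubseqIdentification.RoomEntropy
  (frozenDriver frozenDriver_apply)

/-! ## Per-scale passage data from bounded exact martingales -/

section Bounded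

variable {Ω' : ℕ → Type*} {mΩ' : ∀ k, MeasurableSpace (Ω' k)} {P : ∀ k, Measure (Ω' k)}
  [∀ k, IsProbabilityMeasure (P k)]

/-- **Per-scale passage data from bounded exact martingales** (para twin of
`Process.exists_passageData_of_doob`). Probability spaces `(Ω' k, P k)`; real processes `V k`
(driver values) and complex targets `Φ k u`; a constant `C`; times `S_i ≤ s`, `t`; a measurable
cylinder function `|ψ| ≤ 1`. Hypothesis `hD`: for all small `ρ > 0` and all large `k` there are a
filtration `𝒢`, a complex `𝒢`-martingale `G` with `‖G_m‖ ≤ C`, stopping times `σ ≤ τ ≤ M` with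
every `V^k_u`, `u ≤ s`, measurable for `𝒢_σ`, and a measurable `bad` with `P_k(bad) ≤ ρ`, off which
`G_σ` (`G_τ`) is within `ρ` of `Φ^k_u` at some `u ∈ [s, s + ρ]` (`[t, t + ρ]`). Conclusion: null
sequences `ε, Δ, η` and, for EVERY `k`, integrable `A, B` and `bad` with `P_k(bad) ≤ η_k`,
`∫⁻_{bad} ‖A‖ₑ, ∫⁻_{bad} ‖B‖ₑ ≤ η_k`, `E_k[(B - A) ψ(V^k_S)] = 0`, and a.e. off `bad` the
approximations within `ε_k` at times within `Δ_k`. [cite: CDHKSCRAS2014, §3] -/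
theorem exists_passageData_of_bounded
    {V : ∀ k, ℝ≥0 → Ω' k → ℝ} {Φ : ∀ k, ℝ≥0 → Ω' k → ℂ} (C : ℝ) (s t : ℝ≥0) {n : ℕ}
    {S : Fin n → ℝ≥0} (hS : ∀ i, S i ≤ s) {ψ : (Fin n → ℝ) → ℝ} (hψm : Measurable ψ)
    (hψ1 : ∀ v, |ψ v| ≤ 1)
    (hD : ∀ᶠ ρ in 𝓝[>] (0 : ℝ), ∀ᶠ k in atTop,
      ∃ (𝒢 : Filtration ℕ (mΩ' k)) (G : ℕ → Ω' k → ℂ) (σ τ : Ω' k → WithTop ℕ)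
        (hσ : IsStoppingTime 𝒢 σ) (M : ℕ) (bad : Set (Ω' k)),
        IsStoppingTime 𝒢 τ ∧ Martingale G 𝒢 (P k) ∧ σ ≤ τ ∧ (∀ ω, τ ω ≤ M) ∧
        (∀ u, u ≤ s → Measurable[hσ.measurableSpace] (V k u)) ∧ (∀ m ω, ‖G m ω‖ ≤ C) ∧
        MeasurableSet bad ∧ P k bad ≤ ENNReal.ofReal ρ ∧
        ∀ ω, ω ∉ bad →
          (∃ u : ℝ≥0, s ≤ u ∧ (u : ℝ) ≤ s + ρ ∧ ‖stoppedValue G σ ω - Φ k u ω‖ ≤ ρ) ∧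
          (∃ u : ℝ≥0, t ≤ u ∧ (u : ℝ) ≤ t + ρ ∧ ‖stoppedValue G τ ω - Φ k u ω‖ ≤ ρ)) :
    ∃ ε Δ η : ℕ → ℝ≥0, Tendsto ε atTop (𝓝 0) ∧ Tendsto Δ atTop (𝓝 0) ∧ Tendsto η atTop (𝓝 0) ∧
      ∀ k, ∃ (A B : Ω' k → ℂ) (bad : Set (Ω' k)), MeasurableSet bad ∧ P k bad ≤ η k ∧
        Integrable A (P k) ∧ Integrable B (P k) ∧
        ∫⁻ ω in bad, ‖A ω‖ₑ ∂P k ≤ η k ∧ ∫⁻ ω in bad, ‖B ω‖ₑ ∂P k ≤ η k ∧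
        ∫ ω, (B ω - A ω) * (ψ (fun i ↦ V k (S i) ω) : ℂ) ∂P k = 0 ∧
        ∀ᵐ ω ∂P k, ω ∉ bad →
          (∃ u ∈ Icc s (s + Δ k), ‖A ω - Φ k u ω‖ ≤ ε k) ∧
          (∃ u ∈ Icc t (t + Δ k), ‖B ω - Φ k u ω‖ ≤ ε k) := by
  -- adapted from `Process.exists_passageData_of_doob` (Literature/Probability/Process/DoobPassageData)
  classical
  obtain ⟨ρ₀, hρ₀, hD'⟩ := mem_nhdsGT_iff_exists_Ioo_subset.1 hD
  rw [mem_Ioi] at hρ₀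
  -- precision level `j`: tolerance `ρj j = min (ρ₀/2) (1/(j+1))`
  set ρj : ℕ → ℝ := fun j ↦ min (ρ₀ / 2) (1 / ((j : ℝ) + 1)) with hρj
  have hρj_pos : ∀ j, 0 < ρj j := fun j ↦ by rw [hρj]; positivity
  have hρj_lt : ∀ j, ρj j < ρ₀ := fun j ↦ (min_le_left _ _).trans_lt (by linarith)
  have hρj_le : ∀ j, ρj j ≤ 1 / ((j : ℝ) + 1) := fun j ↦ min_le_right _ _
  obtain ⟨J, hJ, hJgood⟩ :=
    Literature.Probability.Process.exists_tendsto_atTop_eventually_of_forall_eventually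
      fun j ↦ hD' ⟨hρj_pos j, hρj_lt j⟩
  obtain ⟨K₀, hK₀⟩ := eventually_atTop.1 hJgood
  -- the sequences
  have hρJ : Tendsto (fun k ↦ ρj (J k)) atTop (𝓝 0) :=
    squeeze_zero (fun k ↦ (hρj_pos _).le) (fun k ↦ hρj_le _)
      ((tendsto_one_div_add_atTop_nhds_zero_nat (𝕜 := ℝ)).comp hJ)
  set C₀ : ℝ := max C 0 + 1 with hC₀
  have hC₀1 : 1 ≤ C₀ := by rw [hC₀]; linarith [le_max_right C 0]
  have hCC₀ : C ≤ C₀ := by rw [hC₀]; linarith [le_max_left C 0]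
  refine ⟨fun k ↦ ⟨ρj (J k), (hρj_pos _).le⟩, fun k ↦ ⟨ρj (J k), (hρj_pos _).le⟩,
    fun k ↦ if K₀ ≤ k then (C₀ * ρj (J k)).toNNReal else 1, ?_, ?_, ?_, fun k ↦ ?_⟩
  · rw [← NNReal.tendsto_coe]; exact hρJ
  · rw [← NNReal.tendsto_coe]; exact hρJ
  · have h1 : Tendsto (fun k ↦ (C₀ * ρj (J k)).toNNReal) atTop (𝓝 0) := by
      have h := hρJ.const_mul C₀
      rw [mul_zero] at h
      have h2 := (continuous_real_toNNReal.tendsto 0).comp h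
      rwa [Real.toNNReal_zero] at h2
    refine h1.congr' ?_
    filter_upwards [eventually_ge_atTop K₀] with k hk
    rw [if_pos hk]
  -- the data at scale `k`
  dsimp only
  by_cases hk : K₀ ≤ k
  swap
  · refine ⟨0, 0, univ, MeasurableSet.univ, ?_, integrable_zero _ _ _, integrable_zero _ _ _,
      by simp, by simp, by simp, ae_of_all _ fun ω hω ↦ absurd (mem_univ ω) hω⟩
    rw [if_neg hk, measure_univ]
    simp
  obtain ⟨𝒢, G, σ, τ, hσ, M, bad, hτ, hmart, hστ, hτM, hV, hGC, hbad, hPbad, happ⟩ := hK₀ k hk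
  set j := J k with hj
  have hσM : ∀ ω, σ ω ≤ M := fun ω ↦ (hστ ω).trans (hτM ω)
  have hintσ : Integrable (stoppedValue G σ) (P k) :=
    integrable_stoppedValue ℕ hσ hmart.integrable hσM
  have hintτ : Integrable (stoppedValue G τ) (P k) :=
    integrable_stoppedValue ℕ hτ hmart.integrable hτM
  have hη : (if K₀ ≤ k then (C₀ * ρj (J k)).toNNReal else 1) = (C₀ * ρj j).toNNReal := by
    rw [if_pos hk]
  have hC₀ρ : (((C₀ * ρj j).toNNReal : ℝ≥0) : ℝ≥0∞) = ENNReal.ofReal (C₀ * ρj j) := rfl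
  -- the tail bound at a stopping time: `‖G_ϑ‖ ≤ C` everywhere
  have htailθ : ∀ ϑ : Ω' k → WithTop ℕ,
      ∫⁻ ω in bad, ‖stoppedValue G ϑ ω‖ₑ ∂P k ≤ ((C₀ * ρj j).toNNReal : ℝ≥0) := by
    intro ϑ
    have h1 : ∀ ω, ‖stoppedValue G ϑ ω‖ₑ ≤ ENNReal.ofReal C₀ := fun ω ↦ by
      rw [← ofReal_norm]
      exact ENNReal.ofReal_le_ofReal ((hGC _ ω).trans hCC₀)
    calc ∫⁻ ω in bad, ‖stoppedValue G ϑ ω‖ₑ ∂P k ≤ ∫⁻ _ in bad, ENNReal.ofReal C₀ ∂P k :=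
          lintegral_mono fun ω ↦ h1 ω
      _ = ENNReal.ofReal C₀ * P k bad := by rw [lintegral_const, Measure.restrict_apply_univ]
      _ ≤ ENNReal.ofReal C₀ * ENNReal.ofReal (ρj j) := by gcongr
      _ = ENNReal.ofReal (C₀ * ρj j) := (ENNReal.ofReal_mul (by linarith)).symm
  refine ⟨stoppedValue G σ, stoppedValue G τ, bad, hbad, ?_, hintσ, hintτ, ?_, ?_, ?_,
    ae_of_all _ fun ω hω ↦ ?_⟩
  · -- `P bad ≤ η`
    rw [hη, hC₀ρ]
    refine hPbad.trans (ENNReal.ofReal_le_ofReal ?_)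
    have := hρj_pos j
    nlinarith
  · rw [hη]; exact htailθ σ
  · rw [hη]; exact htailθ τ
  · -- optional sampling, pairing form
    exact Literature.Probability.Process.integral_stoppedValue_sub_mul_cylinder_eq_zero hmart hσ
      hτ hστ hτM (fun i ↦ hV (S i) (hS i)) hψm hψ1
  · obtain ⟨⟨u, hsu, hus, hA⟩, ⟨u', htu, hut, hB⟩⟩ := happ ω hω
    refine ⟨⟨u, ⟨hsu, ?_⟩, hA⟩, ⟨u', ⟨htu, ?_⟩, hB⟩⟩
    · rw [← NNReal.coe_le_coe, NNReal.coe_add]; exact hus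
    · rw [← NNReal.coe_le_coe, NNReal.coe_add]; exact hut

end Bounded

/-! ## The far-driver level -/

/-- The event "the path reaches absolute value `≥ Ξ` at some time `≤ T`" is CLOSED in
`C([0,∞), ℝ)`: its complement `{V | V maps [0, T] into (-Ξ, Ξ)}` is a basic open set of the
compact-open topology. [folklore] -/
theorem isClosed_setOf_exists_le_abs (T : ℝ≥0) (Ξ : ℝ) :
    IsClosed {V : C(ℝ≥0, ℝ) | ∃ u ∈ Icc (0 : ℝ≥0) T, Ξ ≤ |V u|} := by
  have h : {V : C(ℝ≥0, ℝ) | ∃ u ∈ Icc (0 : ℝ≥0) T, Ξ ≤ |V u|}ᶜ =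
      {V : C(ℝ≥0, ℝ) | MapsTo V (Icc (0 : ℝ≥0) T) (Ioo (-Ξ) Ξ)} := by
    ext V
    simp only [mem_compl_iff, mem_setOf_eq, not_exists, not_and, not_le, MapsTo, mem_Ioo, abs_lt]
  rw [← isOpen_compl_iff, h]
  exact ContinuousMap.isOpen_setOf_mapsTo isCompact_Icc isOpen_Ioo

/-- **The far-driver level.** For a probability law `μ` on curve classes, the Borel driving process
`W = drivingFunction φ` of a chordal uniformizing map `φ`, a horizon `T` and `ρ > 0`, there is a level
`Ξ > 0` such that: along EVERY sequence of random continuous paths `𝒱 n` (on probability spaces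
`(Ωs n, P n)`) converging in distribution to the frozen driver `frozenDriver φ S₀` with `S₀ ≤ 1`, for
all large `n` the event `{∃ u ≤ T, Ξ ≤ |𝒱 n u|}` has `P n`-probability `< ρ` (the limit event is
contained in `{sup_{[0, T+1]} |W| ≥ Ξ}`, `μ`-small for large `Ξ` by continuity of the paths; the
event is closed, so the portmanteau theorem applies). [cite: BillingsleyCPM1999, Thm. 2.1] -/
theorem exists_farLevel {D : DobrushinDomain} {φ : ConformalEquiv upperHalfPlaneSet D.carrier}
    (hφ : D.IsChordalUniformizing φ) {μ : Measure (CurveClass ℂ)} [IsProbabilityMeasure μ]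
    (T : ℝ≥0) {ρ : ℝ} (hρ : 0 < ρ) :
    ∃ Ξ : ℝ, 0 < Ξ ∧ ∀ (S₀ : ℝ≥0), S₀ ≤ 1 →
      ∀ {Ωs : ℕ → Type} {mΩs : ∀ n, MeasurableSpace (Ωs n)} (P : ∀ n, Measure (Ωs n))
        [∀ n, IsProbabilityMeasure (P n)] (𝒱 : ∀ n, Ωs n → C(ℝ≥0, ℝ)),
        TendstoInDistribution 𝒱 atTop (frozenDriver φ S₀) P μ →
        ∀ᶠ n in atTop, P n {γ | ∃ u ∈ Icc (0 : ℝ≥0) T, Ξ ≤ |𝒱 n γ u|} < ENNReal.ofReal ρ := by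
  -- the limit events `E Ξ = {∃ u ≤ T + 1, Ξ ≤ |W u|}` decrease to `∅`
  set pth : CurveClass ℂ → C(ℝ≥0, ℝ) := fun c ↦
    ⟨drivingFunction φ c, continuous_drivingFunction φ c⟩ with hpth
  have hpm : Measurable pth := measurable_drivingPathOf hφ
  set E : ℕ → Set (CurveClass ℂ) := fun N ↦
    pth ⁻¹' {V : C(ℝ≥0, ℝ) | ∃ u ∈ Icc (0 : ℝ≥0) (T + 1), ((N : ℝ) + 1) ≤ |V u|} with hE
  have hEm : ∀ N, MeasurableSet (E N) := fun N ↦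
    hpm (isClosed_setOf_exists_le_abs (T + 1) _).measurableSet
  have hanti : Antitone E := by
    intro N N' hNN' c hc
    obtain ⟨u, hu, hle⟩ := hc
    exact ⟨u, hu, le_trans (by exact_mod_cast Nat.add_le_add_right hNN' 1) hle⟩
  have hinter : ⋂ N, E N = ∅ := by
    refine eq_empty_of_forall_notMem fun c hc ↦ ?_
    rw [mem_iInter] at hc
    obtain ⟨B, hB⟩ := (isCompact_Icc (a := (0 : ℝ≥0)) (b := T + 1)).exists_bound_of_continuousOn
      (f := fun u ↦ drivingFunction φ c u) (continuous_drivingFunction φ c).continuousOn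
    obtain ⟨N, hN⟩ := exists_nat_gt B
    obtain ⟨u, hu, hle⟩ := hc N
    have := hB u hu
    rw [Real.norm_eq_abs] at this
    change ((N : ℝ) + 1) ≤ |drivingFunction φ c u| at hle
    linarith
  have htend : Tendsto (μ ∘ E) atTop (𝓝 0) := by
    have := tendsto_measure_iInter_atTop (μ := μ) (fun N ↦ (hEm N).nullMeasurableSet) hanti
      ⟨0, measure_ne_top _ _⟩
    rwa [hinter, measure_empty] at this
  obtain ⟨N, hN⟩ := ((tendsto_order.1 htend).2 _ (ENNReal.ofReal_pos.2 hρ)).exists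
  refine ⟨(N : ℝ) + 1, by positivity, fun S₀ hS₀ Ωs mΩs P _ 𝒱 hlaw ↦ ?_⟩
  set F : Set C(ℝ≥0, ℝ) := {V | ∃ u ∈ Icc (0 : ℝ≥0) T, ((N : ℝ) + 1) ≤ |V u|} with hF
  have hFc : IsClosed F := isClosed_setOf_exists_le_abs T _
  -- the limit event is small
  have hsub : frozenDriver φ S₀ ⁻¹' F ⊆ E N := by
    rintro c ⟨u, hu, hle⟩
    refine ⟨max u S₀, ⟨bot_le, max_le (hu.2.trans le_self_add) (hS₀.trans le_add_self)⟩, ?_⟩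
    simpa [hpth, frozenDriver_apply] using hle
  have hμF : (μ.map (frozenDriver φ S₀)) F < ENNReal.ofReal ρ := by
    rw [Measure.map_apply_of_aemeasurable hlaw.aemeasurable_limit hFc.measurableSet]
    exact (measure_mono hsub).trans_lt hN
  -- portmanteau along the sequence
  have hls := ProbabilityMeasure.limsup_measure_closed_le_of_tendsto hlaw.tendsto hFc
  have hev := Filter.eventually_lt_of_limsup_lt (hls.trans_lt hμF)
  filter_upwards [hev] with n hn
  have h1 : (P n).map (𝒱 n) F = P n (𝒱 n ⁻¹' F) :=
    Measure.map_apply_of_aemeasurable (hlaw.forall_aemeasurable n) hFc.measurableSet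
  have hn' : (P n).map (𝒱 n) F < ENNReal.ofReal ρ := hn
  rwa [h1] at hn'

/-! ## The frozen extension of a complex cylinder identity -/

/-- **A complex cylinder identity known for `0 < s < t < T` holds for all `s ≤ t`** when the
complex process `X` has continuous paths, is a.e. strongly measurable and bounded, and is frozen
after `T` (`X_u = X_T`, `u ≥ T`), and the test function `Ψ` is real, a.e. strongly measurable with
`|Ψ| ≤ 1` (finite measure): real and imaginary parts through
`Process.integral_sub_mul_eq_zero_of_forall_lt_of_frozen` and
`Process.integral_sub_mul_eq_zero_zero_of_forall_pos`. [cite: CDHKSCRAS2014, §3] -/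
theorem integral_sub_mul_eq_zero_of_forall_lt_of_frozen_complex {Ω : Type*}
    {mΩ : MeasurableSpace Ω} {μ : Measure Ω} [IsFiniteMeasure μ] {X : ℝ≥0 → Ω → ℂ} {T : ℝ≥0}
    (hfrozen : ∀ u, T ≤ u → ∀ ω, X u ω = X T ω) (hcont : ∀ ω, Continuous fun u ↦ X u ω)
    (hmeas : ∀ u, AEStronglyMeasurable (X u) μ) {C : ℝ} (hbd : ∀ u ω, ‖X u ω‖ ≤ C)
    {Ψ : Ω → ℝ} (hΨm : AEStronglyMeasurable Ψ μ) (hΨ1 : ∀ ω, |Ψ ω| ≤ 1)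
    (h : ∀ s t : ℝ≥0, 0 < s → s < t → t < T → ∫ ω, (X t ω - X s ω) * (Ψ ω : ℂ) ∂μ = 0)
    {s t : ℝ≥0} (hst : s ≤ t) :
    ∫ ω, (X t ω - X s ω) * (Ψ ω : ℂ) ∂μ = 0 := by
  -- the identity read through a real continuous linear form `L` (= `Re`, `Im`)
  have hint : ∀ s t : ℝ≥0, Integrable (fun ω ↦ (X t ω - X s ω) * (Ψ ω : ℂ)) μ := by
    intro s t
    refine Integrable.mul_bdd ?_ (Complex.continuous_ofReal.comp_aestronglyMeasurable hΨm)
      (c := 1) (ae_of_all _ fun ω ↦ by rw [Complex.norm_real, Real.norm_eq_abs]; exact hΨ1 ω)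
    exact Integrable.of_bound ((hmeas t).sub (hmeas s)) (C + C)
      (ae_of_all _ fun ω ↦ (norm_sub_le _ _).trans (add_le_add (hbd t ω) (hbd s ω)))
  have hL : ∀ (L : ℂ →L[ℝ] ℝ) (s t : ℝ≥0),
      L (∫ ω, (X t ω - X s ω) * (Ψ ω : ℂ) ∂μ) = ∫ ω, (L (X t ω) - L (X s ω)) * Ψ ω ∂μ := by
    intro L s t
    rw [← L.integral_comp_comm (hint s t)]
    refine integral_congr_ae (ae_of_all _ fun ω ↦ ?_)
    show L ((X t ω - X s ω) * (Ψ ω : ℂ)) = (L (X t ω) - L (X s ω)) * Ψ ω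
    rw [mul_comm (X t ω - X s ω), ← Complex.real_smul, L.map_smul, map_sub, smul_eq_mul, mul_comm]
  have hreal : ∀ L : ℂ →L[ℝ] ℝ, ∫ ω, (L (X t ω) - L (X s ω)) * Ψ ω ∂μ = 0 := by
    intro L
    have hLb : ∀ u ω, |L (X u ω)| ≤ ‖L‖ * C := fun u ω ↦ by
      rw [← Real.norm_eq_abs]
      exact (L.le_opNorm _).trans (mul_le_mul_of_nonneg_left (hbd u ω) (norm_nonneg _))
    have hLm : ∀ u, AEStronglyMeasurable (fun ω ↦ L (X u ω)) μ := fun u ↦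
      L.continuous.comp_aestronglyMeasurable (hmeas u)
    have hLc : ∀ ω, Continuous fun u ↦ L (X u ω) := fun ω ↦ L.continuous.comp (hcont ω)
    refine Literature.Probability.Process.integral_sub_mul_eq_zero_of_forall_lt_of_frozen
      (X := fun u ω ↦ L (X u ω)) (T := T) (fun u hu ω ↦ by simp only [hfrozen u hu ω]) hLc hLm hLb
      hΨm hΨ1 (fun t' hst' ht'T ↦ ?_) hst
    rcases eq_or_ne s 0 with hs0 | hs0
    · subst hs0
      exact Literature.Probability.Process.integral_sub_mul_eq_zero_zero_of_forall_pos
        (X := fun u ω ↦ L (X u ω)) hLc hLm hLb hΨm hΨ1 hst' fun s₁ hs₁ hs₁t ↦ by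
          rw [← hL, h s₁ t' hs₁ hs₁t ht'T, map_zero]
    · rw [← hL, h s t' (pos_iff_ne_zero.2 hs0) hst' ht'T, map_zero]
  apply Complex.ext
  · rw [show (∫ ω, (X t ω - X s ω) * (Ψ ω : ℂ) ∂μ).re = Complex.reCLM (∫ ω, (X t ω - X s ω) *
      (Ψ ω : ℂ) ∂μ) from rfl, hL, hreal, Complex.zero_re]
  · rw [show (∫ ω, (X t ω - X s ω) * (Ψ ω : ℂ) ∂μ).im = Complex.imCLM (∫ ω, (X t ω - X s ω) *
      (Ψ ω : ℂ) ∂μ) from rfl, hL, hreal, Complex.zero_im]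

end Summit.CriticalPhenomena.SAWScalingLimit.Theorems.SubseqIdentification.ParaMartingale

end
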